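import Mathlib
import Summits.PneNP.PneNP.Theses.OneSlice
import Summits.PneNP.PneNP.Theorems.OneSliceSliceTargetSplit
import Summits.PneNP.PneNP.Theorems.OneSliceSliceTargetSplitStability
import Summits.PneNP.PneNP.Theorems.OneSliceMonotoneContinuationDefs
import Summits.PneNP.PneNP.Theorems.OneSliceMonotoneContinuationSamplerBounds
import Summits.PneNP.PneNP.Theorems.OneSliceMonotoneContinuationSamplerCircuit
import Summits.PneNP.PneNP.Theorems.OneSliceMonotoneContinuationDerandomizeGeneral
import Summits.PneNP.PneNP.Theorems.OneSliceMonotoneContinuationBridgeStep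
import Summits.PneNP.PneNP.Theorems.OneSliceMonotoneContinuationBridgeFacts

/-!
# Route OneSlice, crux `MonotoneContinuation` (stmt-PneNP-18471), line `Sketch_ideator1_r1` — the bridge `MC → flat-above`

`mcImpliesFlatAbove`: ASSUMING the crux `OneSlice.MonotoneContinuation`, every monotone circuit of size `≤ n^c` whose
slice-`j` function has a near-monotone transport (`j` central, at or below the threshold level `m`) admits a monotone
circuit of size `≤ n^{c'+4}` that is `η`-faithful on slice `j` and whose acceptance profile rises by at most `η` over the
next `L⌊√j⌋` levels.  Together with `monotoneContinuation_flat` (FSA ⇒ MC, file `…Partial`) this certifies that the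
residual stub `FlatSliceApprox` of the line is, on the low side `j ≤ m`, EQUIVALENT to the crux (the high side needs the
mirror-image deletion representative).  Construction: the crux gives `C'` close to the transport in `L¹(G(n,p_c))`;
pad by a uniformly random edge set of uniformly random size in a `√m`-window (`padLaw`); take a derandomised majority of
`t` padded copies of `C'` (`bridge_step`: `derandomize_general` against the two-slice test measure, `stub_samplerCircuit`);
accuracy on slice `j` is the exact identity `votes_level_base`, flatness (`bridge_flat`) comes from chain constancy and the
cheap near-Booleanness below the upper shell.
-/

set_option linter.dupNamespace false -- `Summit.PneNP.PneNP.…`: summit = sub-problem (D-0017)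

namespace Summit.PneNP.PneNP.Theorems.MonotoneContinuation

open Literature.Computability.Complexity hiding supp mem_supp
open Finset hiding slice
open Filter hiding mem_sdiff
open Classical
open Summit.PneNP.PneNP.Theorems (card_slice binomialWeight_tail_le binomialWeight_nonneg)
open Summit.PneNP.PneNP.Theorems.ConstantBand.Negative (Edge thr Central slice)
open Summit.PneNP.PneNP.Theorems.SingleThreshold.Negative (pc tendsto_pc)
open Summit.PneNP.PneNP.Theorems.SliceACZero.Negative (supp mem_supp card_supp)
open Summit.PneNP.PneNP.Theorems.SliceTargetSplit (nbhd mem_nbhd transport ind l1 card_nbhd_of_le comp_iff_supp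
  transport_ind_mem ind_nonneg ind_le_one l1_triangle l1_nonneg transport_nonneg rdist_eq_l1)

noncomputable section

variable {n : ℕ}

/-! ## Part 3e — derandomisation on the two slices, flatness, and the bridge theorem -/

/-- **Both slices at once.** With the hypotheses of `bridge_sliceError` for the base slice `j` and the upper slice
`i₂ = j + L⌊√j⌋ + 1`, some `t` fixed paddings have a majority vote that is `2(4/t + 6E₀)`-accurate on slice `j`
(against the slice function) and on slice `i₂` (against the rounded transport), and the transport is near-Boolean on
slice `i₂`. -/
theorem bridge_step {p : ℝ} (hp0 : 0 < p) (hp2 : p ≤ 1 / 2) {m L j t : ℕ} (ht : 0 < t)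
    (hmμ : (m : ℝ) ≤ ((n.choose 2 : ℕ) : ℝ) * p) (hμm : ((n.choose 2 : ℕ) : ℝ) * p < m + 1)
    (hq : L + 8 ≤ Nat.sqrt m) (hsm : 40 * (((L : ℝ) + 6) / 2) ≤ Real.sqrt m)
    (hN : 8 * (L + 2) * m ≤ n.choose 2) (hjm : j ≤ m)
    (f' g₀ F : (Edge n → Bool) → Bool) {ε ηMC c₀ : ℝ} (hc₀ : 0 < c₀)
    (hF : l1 n p (ind F) (transport j (ind g₀)) ≤ ε) (hclose : l1 n p (ind f') (transport j (ind g₀)) ≤ ηMC)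
    (hU : c₀ ≤ ∑ u ∈ (range (n.choose 2 + 1)).filter (fun u : ℕ =>
        (m : ℝ) + ((L + 6 : ℕ) : ℝ) * Real.sqrt m ≤ u ∧ (u : ℝ) ≤ m + 2 * ((L + 6 : ℕ) : ℝ) * Real.sqrt m), binW (n.choose 2) p u) :
    j + L * Nat.sqrt j + 1 ≤ n.choose 2 ∧
    ∑ y ∈ slice n (j + L * Nat.sqrt j + 1), transport j (ind g₀) y * (1 - transport j (ind g₀) y) ≤
      #(slice n (j + L * Nat.sqrt j + 1)) * (ε / c₀) ∧
    ∃ ρs : Fin t → Edge n → Bool,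
      ∑ x ∈ slice n j, |ind (majVote fun a y => f' (fun e => y e || ρs a e)) x - ind g₀ x| ≤
        #(slice n j) * (2 * (4 / t + 6 * (2 / cbConst L * ηMC + 10 * (ε / c₀) + 7 / 2 * (20 * (m : ℝ) / (n.choose 2))))) ∧
      ∑ x ∈ slice n (j + L * Nat.sqrt j + 1), |ind (majVote fun a y => f' (fun e => y e || ρs a e)) x -
          ind (fun u => decide ((1 : ℝ) / 2 ≤ transport j (ind g₀) u)) x| ≤
        #(slice n (j + L * Nat.sqrt j + 1)) * (2 * (4 / t + 6 * (2 / cbConst L * ηMC + 10 * (ε / c₀) + 7 / 2 * (20 * (m : ℝ) / (n.choose 2))))) := by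
  set N := n.choose 2 with hNdef
  set q := Nat.sqrt m with hqdef
  set i₂ := j + L * Nat.sqrt j + 1 with hi₂
  set T := transport j (ind g₀) with hTdef
  set rnd : (Edge n → Bool) → Bool := fun u => decide ((1 : ℝ) / 2 ≤ T u) with hrnd
  set A := padWindow N m j with hAdef
  set E₀ : ℝ := 2 / cbConst L * ηMC + 10 * (ε / c₀) + 7 / 2 * (20 * (m : ℝ) / N) with hE₀
  have hqq : q * q ≤ m := Nat.sqrt_le m
  have hq8 : 8 ≤ q := by omega
  have hjq : Nat.sqrt j ≤ q := Nat.sqrt_le_sqrt hjm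
  have hji₂ : j ≤ i₂ := by omega
  have hi₂j : i₂ ≤ j + L * q + 1 := by
    have := Nat.mul_le_mul_left L hjq
    omega
  have hjj : j ≤ j + L * q + 1 := by omega
  have hLq : L * q + 1 ≤ m := by nlinarith
  have hi₂N : i₂ ≤ N := by nlinarith
  have hjN : j ≤ N := hji₂.trans hi₂N
  -- the two slice errors
  have hEj : ∑ x ∈ slice n j, |∑ ρ, padLaw n A ρ * ind f' (fun e => x e || ρ e) - ind g₀ x| ≤ #(slice n j) * E₀ :=
    bridge_sliceError hp0 hp2 hmμ hμm hq hsm hN hjm le_rfl hjj f' g₀ F (ind g₀) hc₀ hF hclose hU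
      (fun l _ => votes_slice_base j (j + l) (by omega) f' g₀)
  have hEi : ∑ x ∈ slice n i₂, |∑ ρ, padLaw n A ρ * ind f' (fun e => x e || ρ e) - ind rnd x| ≤ #(slice n i₂) * E₀ :=
    bridge_sliceError hp0 hp2 hmμ hμm hq hsm hN hjm hji₂ hi₂j f' g₀ F (ind rnd) hc₀ hF hclose hU
      (fun l hl => votes_slice_up j i₂ (i₂ + l) hji₂ (by omega)
        (by have := mem_range.1 hl; omega) f' g₀)
  -- near-Booleanness on slice `i₂` (it lies below the upper window)
  have hqr : (q : ℝ) ≤ Real.sqrt m :=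
    Real.le_sqrt_of_sq_le (by exact_mod_cast (show q ^ 2 ≤ m by nlinarith))
  have hnb₂ : ∑ y ∈ slice n i₂, T y * (1 - T y) ≤ #(slice n i₂) * (ε / c₀) := by
    refine nb_bound hp0.le (by linarith) hji₂ g₀ F hc₀ hF _ (fun u hu => ?_) hU
    rw [mem_filter, mem_range] at hu
    refine ⟨?_, Nat.lt_succ_iff.1 hu.1⟩
    have h1 : (i₂ : ℝ) ≤ m + (L + 6) * q := by
      have : i₂ ≤ m + (L + 6) * q := by nlinarith
      exact_mod_cast this
    have h2 : ((L : ℝ) + 6) * q ≤ ((L : ℝ) + 6) * Real.sqrt m := mul_le_mul_of_nonneg_left hqr (by positivity)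
    have h3 := hu.2.1
    push_cast at h3
    have : (i₂ : ℝ) ≤ u := by linarith
    exact_mod_cast this
  refine ⟨hi₂N, hnb₂, ?_⟩
  -- derandomise against the two-slice test measure
  have hA : A.Nonempty := by rw [← card_pos, hAdef, card_padWindow]; omega
  have hAN : ∀ a ∈ A, a ≤ N := by
    intro a ha
    rw [hAdef, mem_padWindow] at ha
    exact (bridge_window (h := 0) hq hqq (Nat.lt_succ_sqrt m) hjm le_rfl hjj hN ha.1 ha.2).1
  set Gfun : (Edge n → Bool) → Bool := fun y => if edgeCount y = j then g₀ y else rnd y with hGfun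
  obtain ⟨ρs, hρs⟩ := derandomize_general n t ht (nuTwo n j i₂) (nuTwo_nonneg j i₂) (nuTwo_sum hjN hi₂N)
    (padLaw n A) (padLaw_nonneg A) (padLaw_sum hA hAN) (fun ρ y => f' (fun e => y e || ρ e)) Gfun
  refine ⟨ρs, ?_⟩
  set U : (Edge n → Bool) → ℝ := fun y => ∑ ρ, padLaw n A ρ * ind (fun y => f' (fun e => y e || ρ e)) y with hUdef
  set Maj := majVote fun a y => f' (fun e => y e || ρs a e) with hMaj
  -- the reference error `Σ ν |U - 𝟙[Gfun]| ≤ E₀`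
  have hGj : ∀ y ∈ slice n j, ind Gfun y = ind g₀ y := by
    intro y hy; simp only [ind, hGfun, (mem_filter.1 hy).2, if_true]
  have hGi : ∀ y ∈ slice n i₂, ind Gfun y = ind rnd y := by
    intro y hy
    have hne : edgeCount y ≠ j := by rw [(mem_filter.1 hy).2]; omega
    simp only [ind, hGfun, hne, if_false]
  have hsj : (0 : ℝ) < #(slice n j) := by exact_mod_cast card_slice_pos hjN
  have hsi : (0 : ℝ) < #(slice n i₂) := by exact_mod_cast card_slice_pos hi₂N
  have hErr : ∑ y, nuTwo n j i₂ y * |U y - ind Gfun y| ≤ E₀ := by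
    rw [sum_nuTwo_mul]
    have h1 : ∑ y ∈ slice n j, |U y - ind Gfun y| ≤ #(slice n j) * E₀ := by
      calc ∑ y ∈ slice n j, |U y - ind Gfun y| = ∑ y ∈ slice n j, |U y - ind g₀ y| :=
            sum_congr rfl fun y hy => by rw [hGj y hy]
        _ ≤ #(slice n j) * E₀ := hEj
    have h2 : ∑ y ∈ slice n i₂, |U y - ind Gfun y| ≤ #(slice n i₂) * E₀ := by
      calc ∑ y ∈ slice n i₂, |U y - ind Gfun y| = ∑ y ∈ slice n i₂, |U y - ind rnd y| :=
            sum_congr rfl fun y hy => by rw [hGi y hy]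
        _ ≤ #(slice n i₂) * E₀ := hEi
    have h1' : (∑ y ∈ slice n j, |U y - ind Gfun y|) / (2 * #(slice n j)) ≤ E₀ / 2 := by
      rw [div_le_iff₀ (by positivity)]; linarith
    have h2' : (∑ y ∈ slice n i₂, |U y - ind Gfun y|) / (2 * #(slice n i₂)) ≤ E₀ / 2 := by
      rw [div_le_iff₀ (by positivity)]; linarith
    linarith
  -- hence `Σ ν |𝟙[Maj] - 𝟙[Gfun]| ≤ 4/t + 6 E₀`
  have hMajG : ∑ y, nuTwo n j i₂ y * |ind Maj y - ind Gfun y| ≤ 4 / t + 6 * E₀ := by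
    have htri : ∀ y, nuTwo n j i₂ y * |ind Maj y - ind Gfun y| ≤
        nuTwo n j i₂ y * |ind Maj y - U y| + nuTwo n j i₂ y * |U y - ind Gfun y| := by
      intro y
      rw [← mul_add]
      exact mul_le_mul_of_nonneg_left (abs_sub_le _ _ _) (nuTwo_nonneg j i₂ y)
    calc ∑ y, nuTwo n j i₂ y * |ind Maj y - ind Gfun y|
        ≤ ∑ y, nuTwo n j i₂ y * |ind Maj y - U y| + ∑ y, nuTwo n j i₂ y * |U y - ind Gfun y| := by
          rw [← sum_add_distrib]; exact sum_le_sum fun y _ => htri y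
      _ ≤ (4 / t + 5 * E₀) + E₀ := by
          refine add_le_add (hρs.trans ?_) hErr
          linarith
      _ = 4 / t + 6 * E₀ := by ring
  -- read off the two slices
  have hread := slice_le_of_nuTwo_le hjN (fun y => abs_nonneg (ind Maj y - ind Gfun y)) hMajG
  constructor
  · calc ∑ x ∈ slice n j, |ind Maj x - ind g₀ x| = ∑ x ∈ slice n j, |ind Maj x - ind Gfun x| :=
          sum_congr rfl fun y hy => by rw [hGj y hy]
      _ ≤ _ := hread.1
  · calc ∑ x ∈ slice n i₂, |ind Maj x - ind rnd x| = ∑ x ∈ slice n i₂, |ind Maj x - ind Gfun x| :=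
          sum_congr rfl fun y hy => by rw [hGi y hy]
      _ ≤ _ := hread.2

/-! ## Registered form of the two-slice step -/

/-- **Both slices of the bridge** (registered sub-goal `bridgeStep` of stmt-PneNP-18471), written out. [folklore] -/
theorem bridgeStep :
  ∀ (n : ℕ) (p : ℝ), 0 < p → p ≤ 1 / 2 → ∀ (m L j t : ℕ), 0 < t →
    (m : ℝ) ≤ ((n.choose 2 : ℕ) : ℝ) * p → ((n.choose 2 : ℕ) : ℝ) * p < m + 1 →
    L + 8 ≤ Nat.sqrt m → 40 * (((L : ℝ) + 6) / 2) ≤ Real.sqrt m → 8 * (L + 2) * m ≤ n.choose 2 → j ≤ m →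
    ∀ (f' g₀ F : (Edge n → Bool) → Bool) (ε ηMC c₀ : ℝ), 0 < c₀ →
    l1 n p (ind F) (transport j (ind g₀)) ≤ ε → l1 n p (ind f') (transport j (ind g₀)) ≤ ηMC →
    c₀ ≤ ∑ u ∈ (range (n.choose 2 + 1)).filter (fun u : ℕ =>
        (m : ℝ) + ((L + 6 : ℕ) : ℝ) * Real.sqrt m ≤ u ∧ (u : ℝ) ≤ m + 2 * ((L + 6 : ℕ) : ℝ) * Real.sqrt m), binW (n.choose 2) p u →
    j + L * Nat.sqrt j + 1 ≤ n.choose 2 ∧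
    ∑ y ∈ slice n (j + L * Nat.sqrt j + 1), transport j (ind g₀) y * (1 - transport j (ind g₀) y) ≤
      #(slice n (j + L * Nat.sqrt j + 1)) * (ε / c₀) ∧
    ∃ ρs : Fin t → Edge n → Bool,
      ∑ x ∈ slice n j, |ind (majVote fun a y => f' (fun e => y e || ρs a e)) x - ind g₀ x| ≤
        #(slice n j) * (2 * (4 / t + 6 * (2 / cbConst L * ηMC + 10 * (ε / c₀) + 7 / 2 * (20 * (m : ℝ) / (n.choose 2))))) ∧
      ∑ x ∈ slice n (j + L * Nat.sqrt j + 1), |ind (majVote fun a y => f' (fun e => y e || ρs a e)) x -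
          ind (fun u => decide ((1 : ℝ) / 2 ≤ transport j (ind g₀) u)) x| ≤
        #(slice n (j + L * Nat.sqrt j + 1)) * (2 * (4 / t + 6 * (2 / cbConst L * ηMC + 10 * (ε / c₀) + 7 / 2 * (20 * (m : ℝ) / (n.choose 2))))) :=
  fun _ _ hp0 hp2 _ _ _ _ ht hmμ hμm hq hsm hN hjm f' g₀ F _ _ _ hc₀ hF hclose hU =>
    bridge_step hp0 hp2 ht hmμ hμm hq hsm hN hjm f' g₀ F hc₀ hF hclose hU

/-- **Faithfulness and flatness from the two slice bounds**, in a clean context: a monotone `Mf` agreeing with the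
majority vote on slices `j` and `i₂`, which is `B`-accurate on slice `j` against `g₀` and on slice `i₂` against the rounded
transport, has profile rise `≤ 2 nbB + 2B` between `j` and any level up to `i₂`. -/
theorem bridge_flat {j i₂ : ℕ} (hi₂N : i₂ ≤ n.choose 2) (hjN : j ≤ n.choose 2) (g₀ Mf Maj : (Edge n → Bool) → Bool)
    (hMmono : Monotone Mf) (hMj : ∀ y ∈ slice n j, Mf y = Maj y) (hMi : ∀ y ∈ slice n i₂, Mf y = Maj y) {B nbB : ℝ}
    (hfaith : ∑ x ∈ slice n j, |ind Maj x - ind g₀ x| ≤ #(slice n j) * B)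
    (hup : ∑ x ∈ slice n i₂, |ind Maj x - ind (fun u => decide ((1 : ℝ) / 2 ≤ transport j (ind g₀) u)) x| ≤ #(slice n i₂) * B)
    (hnb : ∑ y ∈ slice n i₂, transport j (ind g₀) y * (1 - transport j (ind g₀) y) ≤ #(slice n i₂) * nbB) :
    (∑ x ∈ slice n j, |ind Mf x - ind g₀ x| ≤ #(slice n j) * B) ∧
    ∀ r : ℕ, j + r ≤ i₂ → profile Mf (j + r) - profile Mf j ≤ 2 * nbB + 2 * B := by
  have hMj' : ∀ y ∈ slice n j, ind Mf y = ind Maj y := fun y hy => by rw [ind, ind, hMj y hy]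
  have hMi' : ∀ y ∈ slice n i₂, ind Mf y = ind Maj y := fun y hy => by rw [ind, ind, hMi y hy]
  have hfaith' : ∑ x ∈ slice n j, |ind Mf x - ind g₀ x| ≤ #(slice n j) * B := by
    calc ∑ x ∈ slice n j, |ind Mf x - ind g₀ x| = ∑ x ∈ slice n j, |ind Maj x - ind g₀ x| :=
          sum_congr rfl fun y hy => by rw [hMj' y hy]
      _ ≤ _ := hfaith
  refine ⟨hfaith', fun r hr => ?_⟩
  have hsj : (0 : ℝ) < #(slice n j) := by exact_mod_cast card_slice_pos hjN
  have hsi : (0 : ℝ) < #(slice n i₂) := by exact_mod_cast card_slice_pos hi₂N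
  set T := transport j (ind g₀) with hTdef
  have hmono : profile Mf (j + r) ≤ profile Mf i₂ := profile_mono hMmono hr hi₂N
  -- upper slice: `profile Mf i₂ ≤ α + 2 nbB + B`
  have hlev : ∑ y ∈ slice n i₂, T y = #(slice n i₂) * profile g₀ j := sum_slice_transport_ind g₀ hi₂N hjN
  have hpt : ∀ y ∈ slice n i₂, ind Mf y ≤ T y + 2 * (T y * (1 - T y)) +
      |ind Maj y - ind (fun u => decide ((1 : ℝ) / 2 ≤ T u)) y| := by
    intro y hy
    rw [hMi' y hy]
    have hround := votes_abs_sub_round_le (transport_ind_mem (j := j) g₀ y).1 (transport_ind_mem (j := j) g₀ y).2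
    have hrnd : ind (fun u => decide ((1 : ℝ) / 2 ≤ T u)) y = if (1 : ℝ) / 2 ≤ T y then 1 else 0 := by
      simp only [ind, decide_eq_true_eq]
    rw [hrnd]
    have h1 := abs_sub_le (ind Maj y) (if (1 : ℝ) / 2 ≤ T y then 1 else 0) (T y)
    have h2 : ind Maj y - T y ≤ |ind Maj y - T y| := le_abs_self _
    rw [abs_sub_comm] at hround
    linarith
  have hsum : ∑ y ∈ slice n i₂, ind Mf y ≤ #(slice n i₂) * profile g₀ j + 2 * (#(slice n i₂) * nbB) + #(slice n i₂) * B := by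
    calc ∑ y ∈ slice n i₂, ind Mf y
        ≤ ∑ y ∈ slice n i₂, (T y + 2 * (T y * (1 - T y)) + |ind Maj y - ind (fun u => decide ((1 : ℝ) / 2 ≤ T u)) y|) :=
          sum_le_sum hpt
      _ = ∑ y ∈ slice n i₂, T y + 2 * ∑ y ∈ slice n i₂, T y * (1 - T y) +
            ∑ y ∈ slice n i₂, |ind Maj y - ind (fun u => decide ((1 : ℝ) / 2 ≤ T u)) y| := by
          rw [sum_add_distrib, sum_add_distrib, mul_sum]
      _ ≤ #(slice n i₂) * profile g₀ j + 2 * (#(slice n i₂) * nbB) + #(slice n i₂) * B := by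
          rw [hlev]
          exact add_le_add (add_le_add le_rfl (by linarith [hnb])) hup
  have hupper : profile Mf i₂ ≤ profile g₀ j + 2 * nbB + B := by
    rw [profile, div_le_iff₀ hsi]
    linarith [hsum]
  -- base slice: `profile Mf j ≥ α - B`
  have hdiff : ∑ x ∈ slice n j, (ind g₀ x - ind Mf x) ≤ #(slice n j) * B := by
    calc ∑ x ∈ slice n j, (ind g₀ x - ind Mf x) ≤ ∑ x ∈ slice n j, |ind Mf x - ind g₀ x| :=
          sum_le_sum fun x _ => by rw [abs_sub_comm]; exact le_abs_self _
      _ ≤ #(slice n j) * B := hfaith'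
  rw [sum_sub_distrib] at hdiff
  have hlower : profile g₀ j - B ≤ profile Mf j := by
    rw [profile, profile, sub_le_iff_le_add, div_le_iff₀ hsj, add_mul, div_mul_cancel₀ _ hsj.ne']
    linarith
  linarith

/-- **The bridge `MC → flat-above` (low side).** Assuming the crux `OneSlice.MonotoneContinuation`, every small monotone
circuit whose slice-`j` function has a near-monotone transport (`j` central, at or below the threshold level) admits a
polynomial-size monotone representative that is `η`-faithful on slice `j` and whose acceptance profile rises by at most
`η` over the next `L⌊√j⌋` levels — i.e. the residual `FlatSliceApprox` of line `Sketch_ideator1_r1` holds on the low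
side.  Construction: apply the crux to get `C'` close to the transport in `L¹(G(n,p))`, pad by uniformly random edge
sets of a uniformly random size in a `√m`-window (`padLaw`), take a derandomised majority of `t` padded copies of `C'`
(`derandomize_general`, `stub_samplerCircuit`); accuracy on slice `j` is the exact identity `votes_level_base`, flatness
comes from chain constancy and the cheap near-Booleanness below the upper shell. -/
theorem mcImpliesFlatAbove : Summit.PneNP.PneNP.Theses.OneSlice.MonotoneContinuation →
    ∀ c : ℕ, ∃ c₁ : ℕ, ∀ k : ℕ, 3 ≤ k → ∀ η : ℝ, 0 < η → ∀ L : ℕ, ∃ ε : ℝ, 0 < ε ∧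
      ∀ᶠ n : ℕ in atTop, ∀ j : ℕ, Central k n j → j ≤ thr k n →
        ∀ C : Circuit (Edge n), C.IsOver monotoneBasis → C.size ≤ n ^ c →
          (∃ F : (Edge n → Bool) → Bool, Monotone F ∧ l1 n (pc n k) (ind F) (transport j (ind C.eval)) ≤ ε) →
          ∃ C₁ : Circuit (Edge n), C₁.IsOver monotoneBasis ∧ C₁.size ≤ n ^ c₁ ∧
            (∑ x ∈ slice n j, |ind C₁.eval x - ind C.eval x|) ≤ η * #(slice n j) ∧
            ∀ r : ℕ, r ≤ L * Nat.sqrt j → profile C₁.eval (j + r) - profile C₁.eval j ≤ η := by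
  intro hMC c
  have hMC' := hMC
  unfold Summit.PneNP.PneNP.Theses.OneSlice.MonotoneContinuation at hMC'
  obtain ⟨c', hc'⟩ := hMC' c
  refine ⟨c' + 4, fun k hk η hη L => ?_⟩
  -- constants
  obtain ⟨c₀, hc₀, M₀, hshell⟩ := shellMass (L + 6) (by omega)
  have hcb := cbConst_pos L
  set t : ℕ := ⌈64 / η⌉₊ + 1 with htdef
  have ht0 : 0 < t := Nat.succ_pos _
  have ht : (4 : ℝ) / t ≤ η / 16 := by
    have h1 : (64 : ℝ) / η ≤ t := by
      rw [htdef]; push_cast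
      linarith [Nat.le_ceil (64 / η)]
    rw [div_le_iff₀ (by positivity)]
    rw [div_le_iff₀ hη] at h1
    linarith
  obtain ⟨εMC, hεMC, hevMC⟩ := hc' k hk (η * cbConst L / 640) (by positivity)
  refine ⟨min εMC (η * c₀ / 6400), lt_min hεMC (by positivity), ?_⟩
  have hδ : 0 < min (1 / (8 * ((L : ℝ) + 2))) (η / 44800) := lt_min (by positivity) (by positivity)
  filter_upwards [hevMC, eventually_bridge hk M₀ (max (((L : ℝ) + 9) ^ 2) ((40 * (((L : ℝ) + 6) / 2)) ^ 2)) hδ,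
    eventually_size c' t] with n hMCn hfacts hsize
  obtain ⟨hp0, hp8, hn2, hM₀, hM₁n, hpδ, hcen⟩ := hfacts
  intro j hj hjm C hC hCsize hFex
  obtain ⟨F, hFmono, hFε⟩ := hFex
  have hp2 : pc n k ≤ 1 / 2 := by linarith
  obtain ⟨hj1, hjN⟩ := hcen j hj
  -- Step 1: the crux gives `C'`
  obtain ⟨C', hC', hC'size, hclose⟩ := hMCn j hj C hC hCsize ⟨F, hFmono, by
    rw [rdist_eq_l1]; exact hFε.trans (min_le_left _ _)⟩
  rw [rdist_eq_l1] at hclose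
  -- Step 2: the arithmetic facts at this `n`
  have hmμ : (thr k n : ℝ) ≤ ((n.choose 2 : ℕ) : ℝ) * pc n k := Nat.floor_le (mul_nonneg (Nat.cast_nonneg _) hp0.le)
  have hμm : ((n.choose 2 : ℕ) : ℝ) * pc n k < thr k n + 1 := Nat.lt_floor_add_one _
  obtain ⟨hq, hsm, hN8, hmN, hp20⟩ := bridge_realfacts hp0 hmμ hpδ (le_trans (le_max_left _ _) hM₁n)
    (le_trans (le_max_right _ _) hM₁n)
  -- Step 3: the two slices
  obtain ⟨hi₂N, hnb₂, ρs, hfaith, hup⟩ := bridge_step hp0 hp2 ht0 hmμ hμm hq hsm hN8 hjm C'.eval C.eval F hc₀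
    hFε hclose (hshell (n.choose 2) (pc n k) hp0 hp2 hM₀).1
  -- Step 4: the circuit, equal to the majority vote off the two extreme inputs
  obtain ⟨M, hMB, hMS, hMev⟩ := (stub_samplerCircuit n t hn2 ht0 C' hC' ρs).2
  obtain ⟨hjN1, hi₂N1⟩ := bridge_natfacts (j := j) hq hjm hN8
  have hMslice : ∀ s, 1 ≤ s → s + 1 ≤ n.choose 2 → ∀ y ∈ slice n s,
      M.eval y = majVote (fun a y => C'.eval (fun e => y e || ρs a e)) y := by
    intro s hs1 hs2 y hy
    have hy' : edgeCount y = s := (mem_filter.1 hy).2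
    obtain ⟨hF', hT'⟩ := bridge_nonextreme (y := y) (by omega) (by omega)
    rw [hMev y hF' hT', majVote_def]
  -- Step 5: accounting
  obtain ⟨hacc, hfin⟩ := bridge_final hη hcb hc₀ rfl (min_le_right εMC (η * c₀ / 6400)) hmN hp20 ht
  have hMmono : Monotone M.eval := M.monotone_eval_of_isOver_monotoneBasis hMB
  obtain ⟨hfaithM, hflatM⟩ := bridge_flat hi₂N hjN C.eval M.eval _ hMmono (hMslice j hj1 hjN1)
    (hMslice _ (by omega) hi₂N1)
    (hfaith.trans (mul_le_mul_of_nonneg_left hacc (Nat.cast_nonneg _)))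
    (hup.trans (mul_le_mul_of_nonneg_left hacc (Nat.cast_nonneg _))) hnb₂
  refine ⟨M, hMB, ?_, ?_, fun r hr => (hflatM r (by omega)).trans hfin⟩
  · -- size
    calc M.size ≤ t * (C'.size + 2 * n.choose 2 + 2) + 4 * t ^ 2 + 4 := hMS
      _ ≤ t * (n ^ c' + 2 * n.choose 2 + 2) + 4 * t ^ 2 + 4 := by
          have := Nat.mul_le_mul_left t (Nat.add_le_add_right (Nat.add_le_add_right hC'size (2 * n.choose 2)) 2)
          omega
      _ ≤ n ^ (c' + 4) := hsize
  · -- faithfulness on slice `j`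
    calc ∑ x ∈ slice n j, |ind M.eval x - ind C.eval x| ≤ #(slice n j) * (η / 5) := hfaithM
      _ ≤ η * #(slice n j) := by nlinarith [(Nat.cast_nonneg _ : (0 : ℝ) ≤ #(slice n j))]

end

end Summit.PneNP.PneNP.Theorems.MonotoneContinuation
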